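import Literature.AlgebraicGeometry.Frobenioids.ArchimedeanBasicProperties
import Literature.AlgebraicGeometry.Frobenioids.AngularFrobenioidsRelative
import Literature.AlgebraicGeometry.Frobenioids.ArchimedeanBaseComparison
import HarnessLib

/-!
# Frobenioids II, Theorem 3.6 (iv), first sentence — PROVED for `C = C^ℤ` and `A` over any base

Mochizuki, *The geometry of Frobenioids II*, Kyushu J. Math. **62** (2008) 401–460, §3, Theorem 3.6
(iv), author's kurims text p. 37 [cite: MochizukiFrdII2008, Thm 3.6 (iv) p.37]:

> "(iv) Let `A ∈ Ob(F)`; `A_D := Base(A) ∈ Ob(D)`. Write `A₀ ∈ Ob(D₀)` for the image of `A_D` in `D₀`.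
> Then the natural action of `Aut_F(A)` on `O^▷(A), O^×(A)` factors through `Aut_{D₀}(A₀)`."

(proof, p. 39: "follow[s] immediately from the definitions"). DISCHARGE of the generic predicate
`ArchFrd.Thm36iv_factors` of `ArchimedeanBasicProperties.lean` at the archimedean Frobenioid
`C = C₀ ×_{D₀} D` of Example 3.3 over any base `π : D → D₀` (seat abc-iut-L1-t6), with `D₀` read in
`ArchBase` through `D0.toArchBase` (faithful, `ArchimedeanBaseComparison.lean`): conjugating a base-identity
linear endomorphism `f = ((id, 1, c), id)` of `A` by an automorphism `α` whose `C₀`-component lies over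
`b ∈ Aut_{D₀}(A₀)` gives `((id, 1, ι_b(c)), id)` — it depends on `α` only through (the Galois twist of)
`b`, i.e. through the image of `α` in `Aut_{D₀}(A₀)`; the statement for the angular Frobenioid `A ⊆ C`
follows along the inclusion (`thm36iv_factors_A`). (The SECOND sentence of (iv) is flag register L1 #6;
see `ArchimedeanAutActionWitness.lean`.) No statement of the paper is strengthened.
-/

namespace Literature.AlgebraicGeometry.Frobenioids

open CategoryTheory

universe v u

namespace ArchFrd

/-- In `ℕ_{≥1}`, `a · b = 1` forces `a = 1` and `b = 1`. [cite: MochizukiFrdI2008, Def. 1.1 (iii) p.19] -/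
theorem pnat_eq_one_of_mul_eq_one {a b : ℕ+} (h : a * b = 1) : a = 1 ∧ b = 1 := by
  have h' : (a : ℕ) * (b : ℕ) = 1 := by rw [← PNat.mul_coe, h]; rfl
  exact ⟨PNat.coe_inj.mp (Nat.eq_one_of_mul_eq_one_right h'),
    PNat.coe_inj.mp (Nat.eq_one_of_mul_eq_one_left h')⟩

variable {D : Type u} [Category.{v} D] (π : D ⥤ D0)

namespace AutAction

variable {π} {A : C π}

/-- The `C₀`-components of an automorphism of `C` compose to identities.
[cite: MochizukiFrdII2008, Thm 3.6 (iv) p.37] -/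
theorem inv_fst_comp_hom_fst (α : A ≅ A) : α.inv.fst ≫ α.hom.fst = 𝟙 A.fst := by
  rw [← CFP.comp_fst, α.inv_hom_id, CFP.id_fst]

/-- … and in the other order. [cite: MochizukiFrdII2008, Thm 3.6 (iv) p.37] -/
theorem hom_fst_comp_inv_fst (α : A ≅ A) : α.hom.fst ≫ α.inv.fst = 𝟙 A.fst := by
  rw [← CFP.comp_fst, α.hom_inv_id, CFP.id_fst]

/-- An automorphism has Frobenius degree `1` (both components). [cite: MochizukiFrdII2008, Thm 3.6 (iv) p.37] -/
theorem degFr_hom_fst (α : A ≅ A) : C0.degFr α.hom.fst = 1 ∧ C0.degFr α.inv.fst = 1 := by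
  have h := congrArg C0.Hom.degFr (inv_fst_comp_hom_fst α)
  change C0.degFr α.inv.fst * C0.degFr α.hom.fst = 1 at h
  exact ⟨(pnat_eq_one_of_mul_eq_one h).2, (pnat_eq_one_of_mul_eq_one h).1⟩

/-- The scalar relation `ι_{b̄}(s) · s̄ = 1` between the scalars `s, s̄` of `α`, `α⁻¹` (`b̄ = Base(α⁻¹)`).
[cite: MochizukiFrdII2008, Thm 3.6 (iv) p.37] -/
theorem act_scalar_mul_scalar_inv (α : A ≅ A) :
    (C0.Base α.inv.fst).act (C0.scalar α.hom.fst) * C0.scalar α.inv.fst = 1 := by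
  have h := congrArg C0.Hom.scalar (inv_fst_comp_hom_fst α)
  change C0.scalar (α.inv.fst ≫ α.hom.fst) = C0.scalar (𝟙 A.fst) at h
  rw [C0.scalar_comp', C0.scalar_id', (degFr_hom_fst α).1, PNat.one_coe, pow_one] at h
  exact h

/-- A base-identity endomorphism of `A ∈ Ob(C)` has `C₀`-component over the identity of `D₀`.
[cite: MochizukiFrdII2008, Thm 3.6 (iv) p.37] -/
theorem base_fst_eq_id_of_snd_eq_id (f : A ⟶ A) (hf : f.snd = 𝟙 A.snd) : C0.Base f.fst = 𝟙 A.fst.base := by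
  have hw := f.w
  rw [hf, CategoryTheory.Functor.map_id, Category.comp_id] at hw
  exact (cancel_mono A.iso.hom).mp (hw.trans (Category.id_comp _).symm)

/-- KEY COMPUTATION: the scalar of `α⁻¹ ≫ f ≫ α` for `f = ((id, 1, c), id) ∈ O^▷(A)` is `ι_{Base(α⁻¹)}(c)`.
[cite: MochizukiFrdII2008, Thm 3.6 (iv) p.37] -/
theorem scalar_conj (α : A ≅ A) (f : A ⟶ A) (hf : f ∈ PreFrobenioid.endSubmonoid (C.toElem π) A) :
    C0.scalar (α.inv ≫ f ≫ α.hom).fst = (C0.Base α.inv.fst).act (C0.scalar f.fst) := by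
  have hfs : f.snd = 𝟙 A.snd := hf.1
  have hfd : C0.degFr f.fst = 1 := hf.2
  have hfb := base_fst_eq_id_of_snd_eq_id f hfs
  rw [CFP.comp_fst, CFP.comp_fst, C0.scalar_comp', C0.scalar_comp', C0.degFr_comp', hfb, hfd,
    (degFr_hom_fst α).1, one_mul, PNat.one_coe, pow_one, pow_one, map_mul]
  change (C0.Base α.inv.fst).act (D0.galAct (D0.Hom.twists (𝟙 A.fst.base)) (C0.scalar α.hom.fst)) *
      (C0.Base α.inv.fst).act (C0.scalar f.fst) * C0.scalar α.inv.fst = _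
  rw [D0.twists_id, D0.galAct_false, mul_right_comm, act_scalar_mul_scalar_inv, one_mul]

/-- The conjugate `α⁻¹ ≫ f ≫ α` of `f ∈ O^▷(A)`: over the identity of `D`, base the identity, degree `1`.
[cite: MochizukiFrdII2008, Thm 3.6 (iv) p.37] -/
theorem conj_components (α : A ≅ A) (f : A ⟶ A) (hf : f ∈ PreFrobenioid.endSubmonoid (C.toElem π) A) :
    (α.inv ≫ f ≫ α.hom).snd = 𝟙 A.snd ∧ C0.Base (α.inv ≫ f ≫ α.hom).fst = 𝟙 A.fst.base ∧
      C0.degFr (α.inv ≫ f ≫ α.hom).fst = 1 := by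
  have hfs : f.snd = 𝟙 A.snd := hf.1
  have hfd : C0.degFr f.fst = 1 := hf.2
  have hsnd : (α.inv ≫ f ≫ α.hom).snd = 𝟙 A.snd := by
    rw [CFP.comp_snd, CFP.comp_snd, hfs, Category.id_comp, ← CFP.comp_snd, α.inv_hom_id, CFP.id_snd]
  refine ⟨hsnd, base_fst_eq_id_of_snd_eq_id _ hsnd, ?_⟩
  rw [CFP.comp_fst, CFP.comp_fst, C0.degFr_comp', C0.degFr_comp', hfd, (degFr_hom_fst α).1,
    (degFr_hom_fst α).2, mul_one, mul_one]

end AutAction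

open AutAction in
/-- **Theorem 3.6 (iv), first sentence, for `C = C^ℤ`** (PROVED): the conjugation action of `Aut_C(A)` on
`O^▷(A)` and on `O^×(A)` factors through `Aut_{D₀}(A₀)` (`D₀` read in `ArchBase` via `D0.toArchBase`).
[cite: MochizukiFrdII2008, Thm 3.6 (iv) p.37] -/
theorem thm36iv_factors_C : Thm36iv_factors (π ⋙ D0.toArchBase) (C.toElem π) := by
  intro A α α' hαα'
  haveI := D0.toArchBase_faithful
  -- same image in `Aut_{D₀}(A₀)`: the arrows of `D₀` under the `C₀`-components agree
  have hp : π.map α.hom.snd = π.map α'.hom.snd := by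
    have h := congrArg Iso.hom hαα'
    exact D0.toArchBase.map_injective h
  have hb : C0.Base α.hom.fst = C0.Base α'.hom.fst := by
    have h1 := α.hom.w
    have h2 := α'.hom.w
    change C0.Base α.hom.fst ≫ A.iso.hom = A.iso.hom ≫ π.map α.hom.snd at h1
    change C0.Base α'.hom.fst ≫ A.iso.hom = A.iso.hom ≫ π.map α'.hom.snd at h2
    rw [← hp] at h2
    exact (cancel_mono A.iso.hom).mp (h1.trans h2.symm)
  have hbi : C0.Base α.inv.fst = C0.Base α'.inv.fst := by
    have h1 : C0.Base α.inv.fst ≫ C0.Base α.hom.fst = 𝟙 _ := by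
      rw [← C0.base_comp', inv_fst_comp_hom_fst, C0.base_id']
    have h2 : C0.Base α'.hom.fst ≫ C0.Base α'.inv.fst = 𝟙 _ := by
      rw [← C0.base_comp', hom_fst_comp_inv_fst, C0.base_id']
    rw [← hb] at h2
    calc C0.Base α.inv.fst = C0.Base α.inv.fst ≫ (C0.Base α.hom.fst ≫ C0.Base α'.inv.fst) := by
          rw [h2, Category.comp_id]
      _ = C0.Base α'.inv.fst := by rw [← Category.assoc, h1, Category.id_comp]
  have key : ∀ f ∈ PreFrobenioid.endSubmonoid (C.toElem π) A,
      α.inv ≫ f ≫ α.hom = α'.inv ≫ f ≫ α'.hom := by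
    intro f hf
    obtain ⟨hs, hB, hd⟩ := conj_components α f hf
    obtain ⟨hs', hB', hd'⟩ := conj_components α' f hf
    refine CFP.hom_ext (C0.hom_ext (hB.trans hB'.symm) (hd.trans hd'.symm) ?_) (hs.trans hs'.symm)
    rw [scalar_conj α f hf, scalar_conj α' f hf, hbi]
  refine ⟨key, fun u hu => ?_⟩
  apply Iso.ext
  change α.inv ≫ u.hom ≫ α.hom = α'.inv ≫ u.hom ≫ α'.hom
  exact key u.hom ⟨hu.1, hu.2⟩

/-- **Theorem 3.6 (iv), first sentence, for the angular Frobenioid `A`** (PROVED): transported from `C`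
along the inclusion `A ⊆ C` (an arrow of `A` is an arrow of `C`; base-identity / linear mean the same
for `A.toElem` and `C.toElem`). [cite: MochizukiFrdII2008, Thm 3.6 (iv) p.37] -/
theorem thm36iv_factors_A : Thm36iv_factors (π ⋙ D0.toArchBase) (A.toElem π) := by
  intro X α α' hαα'
  have hC : (PreFrobenioid.baseFunctor (C.toElem π) ⋙ (π ⋙ D0.toArchBase)).mapIso ((A.ι π).mapIso α) =
      (PreFrobenioid.baseFunctor (C.toElem π) ⋙ (π ⋙ D0.toArchBase)).mapIso ((A.ι π).mapIso α') := by
    apply Iso.ext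
    exact congrArg Iso.hom hαα'
  obtain ⟨keyC, -⟩ := thm36iv_factors_C π X.obj ((A.ι π).mapIso α) ((A.ι π).mapIso α') hC
  have key : ∀ f ∈ PreFrobenioid.endSubmonoid (A.toElem π) X,
      α.inv ≫ f ≫ α.hom = α'.inv ≫ f ≫ α'.hom := by
    intro f hf
    apply WideSubcategory.hom_ext
    exact keyC f.hom ⟨hf.1, hf.2⟩
  refine ⟨key, fun u hu => ?_⟩
  apply Iso.ext
  change α.inv ≫ u.hom ≫ α.hom = α'.inv ≫ u.hom ≫ α'.hom
  exact key u.hom ⟨hu.1, hu.2⟩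

end ArchFrd

end Literature.AlgebraicGeometry.Frobenioids
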